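import Literature.NumberTheory.ConnesConsani2021.ScalingOperator
import Literature.NumberTheory.ConnesConsani2021.ProlateProjections
import HarnessLib

/-!
# Connes–Consani 2021, Prop. 2.2 (iii) in Hilbert–Schmidt form — adapter (RH-FREE, theorems only)

LABEL (line 1): **RH-FREE corpus literature**, bookkeeping between two typings of the same printed
statement; bears_on: W-C/W-P (apex input (A), discharge path D6/W1 of `cc/ASSIGNMENTS.md`); WHAT THIS
IS NOT: any claim about RH; nothing here bears on the truth of RH.

A. Connes, C. Consani, *Weil positivity and trace formula, the archimedean place*, Selecta Math. (N.S.)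
27 (2021) 77 = arXiv:2006.13771 [bib: `ConnesConsani2021`], §2 Prop. 2.2 (iii) (= arXiv Prop. 10
(iii), p. 10): "`Tr(ϑ(f)PP̂P) = ∫₀^∞ f(ρ⁻¹)(δ(ρ) − τ(ρ))d*ρ`" (`= L(f)`, Cor. 2.3).  The statement layer
`SchwartzKernels.lean` types it (for `f = g ∗ g*`) as an `IsLUB` over finite orthonormal families of
`P̂L²(ℝ)_ev = soninSpace 0 1` of the partial sums `Σ_i Re⟨Pξ_i | ϑ(f) Pξ_i⟩` (`CC2021_prop_2_2_iii`).
The Hilbert–Schmidt bookkeeping of `Literature/Analysis/OperatorTheory/HilbertSchmidtPartialSums.lean`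
(seat O4a) and the operators `ϑ(g) = scalingOp g` (`ScalingOperator.lean`), `P = outerProj`
(`ProlateProjections.lean`) let us restate it, EQUIVALENTLY and with proof, as the convergence of the
Hilbert–Schmidt series `Σ_k ‖ϑ(g)* P b_k‖²` to `Re L(g ∗ g*)` along ANY Hilbert basis `(b_k)` of
`soninSpace 0 1` — the form consumed by the D6 composition
(`sum_re_soninTraceForm_le_of_decomposition`, hypothesis `hL`, up to the §4 identity `P̂|_{ev} = P_{S(0,1)}`).

* `soninTraceForm_congr_ae` — the statement layer's plain-function form only depends on a.e. classes;
* `re_soninTraceForm_autocorr_cutoffP` — `Re⟨Pξ | ϑ(g∗g*) Pξ⟩ = ‖ϑ(g)† (outerProj ξ)‖²`;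
* `CC2021_prop_2_2_iii.hasSum_norm_sq` (⇒, every Hilbert basis), `prop_2_2_iii_of_hasSum` (⇐, one
  basis suffices), `CC2021_prop_2_2_iii_iff_hasSum`.

No new definition, no named fact.
-/

noncomputable section

open _root_.MeasureTheory Complex Set
open scoped Real ComplexConjugate InnerProductSpace

namespace Literature.NumberTheory.ConnesConsani2021

open Literature.NumberTheory.LFunctions Literature.Analysis.OperatorTheory

/-- The matrix coefficient `⟨ξ | ϑ(e^τ) η⟩` of the statement layer only depends on the a.e. classes of
`ξ, η` (dilations preserve Lebesgue-null sets); local copy of the lemma of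
`ArchimedeanTraceFormulaProofs` (not imported here to keep this adapter below Thm. 4.7's files).
[cite: ConnesConsani2021, §4 eq. (40) p. 15] -/
private theorem scalingCoeff_congr_ae' {ξ ξ' η η' : ℝ → ℂ} (hξ : ξ =ᵐ[volume] ξ') (hη : η =ᵐ[volume] η')
    (τ : ℝ) : scalingCoeff ξ η τ = scalingCoeff ξ' η' τ := by
  unfold scalingCoeff
  refine integral_congr_ae ?_
  have hη' : (fun v : ℝ => η (Real.exp (-τ) • v)) =ᵐ[volume] fun v => η' (Real.exp (-τ) • v) :=
    ae_eq_comp_smul (V := ℝ) hη (Real.exp_pos (-τ)).ne'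
  filter_upwards [hξ, hη'] with v h1 h2
  simp only [smul_eq_mul] at h2
  rw [h1, h2]

/-- `⟨ξ | ϑ(f) ξ⟩ = soninTraceForm k ξ` only depends on the a.e. class of `ξ`.
[cite: ConnesConsani2021, Prop. 2.2 (iii) p. 10 (proof)] -/
theorem soninTraceForm_congr_ae (k : ℝ → ℂ) {ξ ξ' : ℝ → ℂ} (h : ξ =ᵐ[volume] ξ') :
    soninTraceForm k ξ = soninTraceForm k ξ' := by
  unfold soninTraceForm
  refine integral_congr_ae (Filter.Eventually.of_forall fun τ => ?_)
  simp only [scalingCoeff_congr_ae' h h τ]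

/-- **One term of `Tr(ϑ(f)PP̂P)`**: for `f = g ∗ g*` (`g ∈ L¹`) and `ξ ∈ L²(ℝ)`,
`Re⟨Pξ | ϑ(f) Pξ⟩ = ‖ϑ(g)† (P ξ)‖²`, with the statement layer's function-level `P = cutoffP` on the left
and the operators `outerProj`, `scalingOp g` on the right (`outerProj_coeFn`,
`re_soninTraceForm_autocorr`). [cite: ConnesConsani2021, Prop. 2.2 (iii) p. 10; Cor. 2.3 (i) p. 11 (proof)] -/
theorem re_soninTraceForm_autocorr_cutoffP {g : ℝ → ℂ} (hg : Integrable g)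
    (ξ : Lp ℂ 2 (volume : Measure ℝ)) :
    (soninTraceForm (weilConv g (weilReflect g)) (cutoffP (ξ : ℝ → ℂ))).re =
      ‖ContinuousLinearMap.adjoint (scalingOp g) (outerProj ξ)‖ ^ 2 := by
  rw [soninTraceForm_congr_ae _ (outerProj_coeFn ξ).symm, re_soninTraceForm_autocorr hg]

/-- The set of partial sums in `CC2021_prop_2_2_iii` is the set of Hilbert–Schmidt partial sums of
`T = ϑ(g)† ∘ P` over finite orthonormal families of `soninSpace 0 1`.
[cite: ConnesConsani2021, Prop. 2.2 (iii) p. 10] -/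
theorem setOf_partialSums_eq {g : ℝ → ℂ} (hg : Integrable g) :
    {s : ℝ | ∃ (n : ℕ) (ξ : Fin n → Lp ℂ 2 (volume : Measure ℝ)),
        Orthonormal ℂ ξ ∧ (∀ i, ξ i ∈ soninSpace 0 1) ∧
          s = ∑ i, (soninTraceForm (weilConv g (weilReflect g)) (cutoffP (ξ i : ℝ → ℂ))).re} =
      {s : ℝ | ∃ (n : ℕ) (v : Fin n → Lp ℂ 2 (volume : Measure ℝ)),
        Orthonormal ℂ v ∧ (∀ i, v i ∈ soninSpace 0 1) ∧
          s = ∑ i, ‖(ContinuousLinearMap.adjoint (scalingOp g) ∘L outerProj) (v i)‖ ^ 2} := by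
  ext s
  simp only [Set.mem_setOf_eq, ContinuousLinearMap.comp_apply, re_soninTraceForm_autocorr_cutoffP hg]

/-- **Prop. 2.2 (iii) ⇒ the Hilbert–Schmidt series converges along EVERY Hilbert basis of
`P̂L²(ℝ)_ev = soninSpace 0 1`**: `Σ_k ‖ϑ(g)† P b_k‖² = Re L(g ∗ g*)` (`L = traceL = W_∞ + D`).
PROVED (`hasSum_norm_sq_apply_of_isLUB`). [cite: ConnesConsani2021, §2 Prop. 2.2 (iii) (= arXiv Prop. 10 (iii)) p. 10] -/
theorem CC2021_prop_2_2_iii.hasSum_norm_sq (h : CC2021_prop_2_2_iii) {g : ℝ → ℂ} (hg : IsWeilTest g)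
    {ι : Type*} (b : HilbertBasis ι ℂ (soninSpace 0 1)) :
    HasSum (fun k => ‖ContinuousLinearMap.adjoint (scalingOp g)
        (outerProj (b k : Lp ℂ 2 (volume : Measure ℝ)))‖ ^ 2)
      (traceL (weilConv g (weilReflect g))).re := by
  have hgi : Integrable g := hg.1.continuous.integrable_of_hasCompactSupport hg.2
  set T : Lp ℂ 2 (volume : Measure ℝ) →L[ℂ] Lp ℂ 2 (volume : Measure ℝ) :=
    ContinuousLinearMap.adjoint (scalingOp g) ∘L outerProj with hT
  have hL : IsLUB {s : ℝ | ∃ (n : ℕ) (v : Fin n → Lp ℂ 2 (volume : Measure ℝ)),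
      Orthonormal ℂ v ∧ (∀ i, v i ∈ soninSpace 0 1) ∧ s = ∑ i, ‖T (v i)‖ ^ 2}
      (traceL (weilConv g (weilReflect g))).re := by
    rw [hT, ← setOf_partialSums_eq hgi]
    exact h g hg
  have key := hasSum_norm_sq_apply_of_isLUB b T hL
  simpa only [hT, ContinuousLinearMap.comp_apply] using key

/-- A Hilbert basis of a subspace, read in the ambient space, is orthonormal. [cite: ConnesConsani2021, Prop. 2.2 (iii) p. 10] -/
private theorem orthonormal_coe_hilbertBasis' {ι : Type*} {V : Submodule ℂ (Lp ℂ 2 (volume : Measure ℝ))}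
    (bV : HilbertBasis ι ℂ V) : Orthonormal ℂ fun k => (bV k : Lp ℂ 2 (volume : Measure ℝ)) := by
  classical
  have h := bV.orthonormal
  rw [orthonormal_iff_ite] at h ⊢
  intro i j
  rw [← Submodule.coe_inner]
  exact h i j

/-- **The Hilbert–Schmidt series along ONE Hilbert basis ⇒ Prop. 2.2 (iii) (the `IsLUB` typing)**: the
supremum of the partial sums over all finite orthonormal families of `soninSpace 0 1` is the sum of the
series (every family is dominated, `sum_norm_sq_apply_le_of_hasSum`; basis partial sums are such
families).  PROVED. [cite: ConnesConsani2021, §2 Prop. 2.2 (iii) (= arXiv Prop. 10 (iii)) p. 10] -/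
theorem prop_2_2_iii_of_hasSum
    (H : ∀ g : ℝ → ℂ, IsWeilTest g → ∃ (ι : Type) (b : HilbertBasis ι ℂ (soninSpace 0 1)),
      HasSum (fun k => ‖ContinuousLinearMap.adjoint (scalingOp g)
          (outerProj (b k : Lp ℂ 2 (volume : Measure ℝ)))‖ ^ 2)
        (traceL (weilConv g (weilReflect g))).re) :
    CC2021_prop_2_2_iii := by
  classical
  intro g hg
  have hgi : Integrable g := hg.1.continuous.integrable_of_hasCompactSupport hg.2
  obtain ⟨ι, b, hb⟩ := H g hg
  rw [setOf_partialSums_eq hgi]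
  set T : Lp ℂ 2 (volume : Measure ℝ) →L[ℂ] Lp ℂ 2 (volume : Measure ℝ) :=
    ContinuousLinearMap.adjoint (scalingOp g) ∘L outerProj with hT
  have hb' : HasSum (fun k => ‖T (b k : Lp ℂ 2 (volume : Measure ℝ))‖ ^ 2)
      (traceL (weilConv g (weilReflect g))).re := by
    simpa only [hT, ContinuousLinearMap.comp_apply] using hb
  constructor
  · rintro s ⟨n, v, hv, hvV, rfl⟩
    exact sum_norm_sq_apply_le_of_hasSum b T hb' hv hvV Finset.univ
  · intro M hM
    have hpart : ∀ u : Finset ι, ∑ k ∈ u, ‖T (b k : Lp ℂ 2 (volume : Measure ℝ))‖ ^ 2 ≤ M := by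
      intro u
      refine hM ⟨Fintype.card u, fun i => (b ((Fintype.equivFin u).symm i : ι) : Lp ℂ 2 (volume : Measure ℝ)),
        ?_, ?_, ?_⟩
      · exact (orthonormal_coe_hilbertBasis' b).comp _
          (Subtype.val_injective.comp (Fintype.equivFin u).symm.injective)
      · exact fun i => Submodule.coe_mem _
      · rw [← Finset.sum_coe_sort u, ← (Fintype.equivFin u).symm.sum_comp]
    rw [← hb'.tsum_eq]
    exact Real.tsum_le_of_sum_le (fun k => sq_nonneg _) hpart

/-- **Prop. 2.2 (iii), the two typings are equivalent**: the `IsLUB` statement of `SchwartzKernels.lean`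
holds iff, for every test function `g`, the Hilbert–Schmidt series `Σ_k ‖ϑ(g)† P b_k‖²` converges to
`Re L(g ∗ g*)` along some (equivalently, by `hasSum_norm_sq_apply_of_hasSum_of_mem`, every) Hilbert
basis of `soninSpace 0 1`.  PROVED. [cite: ConnesConsani2021, §2 Prop. 2.2 (iii) (= arXiv Prop. 10 (iii)) p. 10] -/
theorem CC2021_prop_2_2_iii_iff_hasSum :
    CC2021_prop_2_2_iii ↔
      ∀ g : ℝ → ℂ, IsWeilTest g → ∃ (ι : Type) (b : HilbertBasis ι ℂ (soninSpace 0 1)),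
        HasSum (fun k => ‖ContinuousLinearMap.adjoint (scalingOp g)
            (outerProj (b k : Lp ℂ 2 (volume : Measure ℝ)))‖ ^ 2)
          (traceL (weilConv g (weilReflect g))).re := by
  refine ⟨fun h g hg => ?_, prop_2_2_iii_of_hasSum⟩
  obtain ⟨w, b, -⟩ := exists_hilbertBasis ℂ (soninSpace 0 1)
  exact ⟨w, b, h.hasSum_norm_sq hg b⟩

/-- Consequence for Cor. 2.3 (i) in operator language: under Prop. 2.2 (iii), `Re L(g ∗ g*)` is a sum of
squares, hence `≥ 0` (cf. `cor_2_3_i_of_prop_2_2_iii`). [cite: ConnesConsani2021, §2 Cor. 2.3 (i) p. 11 (proof)] -/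
theorem CC2021_prop_2_2_iii.traceL_re_nonneg (h : CC2021_prop_2_2_iii) {g : ℝ → ℂ} (hg : IsWeilTest g) :
    0 ≤ (traceL (weilConv g (weilReflect g))).re := by
  obtain ⟨w, b, -⟩ := exists_hilbertBasis ℂ (soninSpace 0 1)
  exact (h.hasSum_norm_sq hg b).nonneg fun k => sq_nonneg _

end Literature.NumberTheory.ConnesConsani2021

end
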